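import Summits.Ventures.HSemireg.Mod4MiddleMatrixSquareRoot
import Summits.Ventures.HSemireg.Mod4BlockAssembly

/-!
# Venture HSemireg — MOD-4 line: the middle-degree matrix of the CARRIER `q_n hⁿ/n!` and of the O_Z-type shapes
# (THEOREM R_f corollaries (C1) «loci t = C(n,m)²» and (C6) «triangularity», for every `n`)

HONEST FRAMING. Part of the Lean index of the computation cell `pub-hsemireg` (widening group W3, seat w3-mod4-1 gen 5;
files of record `HOME/widen/W3/MOD4-OFFSPLIT-w3mod4.md` §10.2 (C1)/(C6), §10.4, §11).  EXPLICIT `(n+1) × (n+1)` MATRICES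
over a commutative ring / a field ONLY: no abelian variety, no sheaf, no Ext group, no semiregularity map; nothing here says
that HC, HC_CM or HC_AV holds; no Literature fact is declared or used.  THEOREM R_f (whose middle-degree clause reads
`R_n = (r_n + 2)·C(2n,n) − 2r_n − dim ker(M_f − (−1)ⁿτ)`) is NOT asserted here; this file only evaluates its matrix `M_f`
(`Summit.Ventures.HSemireg.Mod4.middleM`, seat g4's `Mod4MiddleMatrixSquareRoot.lean`, with `M_f = (−1)ⁿ·T_f²`) on two shapes:
* the CARRIER `f = q_n hⁿ/n!` (`q_i = [i = n]·c`, the Mukai vector of `O_Z` for an `n`-fold carrier `Z`): `T_f = diag((−1)^a C(n,a) c)`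
  (`hankelT_carrier`), `M_f = diag((−1)ⁿ c² C(n,a)²)` (`middleM_carrier`), hence over a field
  `dim ker(M_f − λ) = #{a ≤ n : (−1)ⁿc²C(n,a)² = λ}` (`finrank_ker_middleM_carrier`) — with `λ = (−1)ⁿτ` this is (C1)'s
  «middle drop = #{m : t = C(n,m)²}, t = τ/c²» (two for `m ≠ n/2`, one for `m = n/2`), the locus list that corrected (E15);
* the O_Z-TYPE shapes `q_0 = … = q_{n−1} = 0` (any `q_n, …, q_{2n}`): `T_f` is upper triangular with diagonal `(−1)^a C(n,a) q_n`
  (`hankelT_OZ_lower_eq_zero`, `hankelT_OZ_diag`), so `M_f − λ` has determinant `∏_a ((−1)ⁿ q_n² C(n,a)² − λ)`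
  (`det_middleM_OZ_sub`): the candidate loci of every O_Z-type shape are the carrier's ((C6) «triangularity»).
All statements and proofs: w3-mod4-1 g5 (2026-08-23).  Namespace `Summit.Ventures.HSemireg.Mod4Site`.
-/

namespace Summit.Ventures.HSemireg.Mod4Site

open Matrix Summit.Ventures.HSemireg.Mod4

section Ring

variable {R : Type*} [CommRing R]

/-- the carrier coefficient sequence `q_i = [i = n]·c` (`f = c·hⁿ/n!`). -/
theorem hankelT_carrier (n : ℕ) (c : R) :
    hankelT n (fun i => if i = n then c else 0) =
      diagonal (fun a : Fin (n + 1) => (-1 : R) ^ (a : ℕ) * (n.choose (a : ℕ) : R) * c) := by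
  ext a b
  simp only [hankelT, diagonal_apply]
  have ha := a.is_lt; have hb := b.is_lt
  by_cases hab : a = b
  · subst hab
    rw [if_pos (by omega), if_pos rfl]
  · have : n - (a : ℕ) + (b : ℕ) ≠ n := fun h => hab (Fin.ext (by omega))
    rw [if_neg this, if_neg hab, mul_zero]

/-- **(C1), matrix form:** for the carrier, `M_f = diag((−1)ⁿ · c² · C(n,a)²)`. -/
theorem middleM_carrier (n : ℕ) (c : R) :
    middleM n (fun i => if i = n then c else 0) =
      diagonal (fun a : Fin (n + 1) => (-1 : R) ^ n * c ^ 2 * (n.choose (a : ℕ) : R) ^ 2) := by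
  rw [middleM_eq_smul_hankelT_sq, hankelT_carrier, diagonal_mul_diagonal, ← diagonal_smul]
  congr 1
  funext a
  simp only [Pi.smul_apply, smul_eq_mul]
  have h : ((-1 : R) ^ (a : ℕ)) * ((-1 : R) ^ (a : ℕ)) = 1 := by rw [← pow_add, ← two_mul, pow_mul, neg_one_sq, one_pow]
  linear_combination ((-1 : R) ^ n * c ^ 2 * (n.choose (a : ℕ) : R) ^ 2) * h

/-- O_Z-type shapes: `q_i = 0` for `i < n` makes `T_f` upper triangular … -/
theorem hankelT_OZ_lower_eq_zero (n : ℕ) (q : ℕ → R) (hq : ∀ i < n, q i = 0) {a b : Fin (n + 1)} (hba : b < a) :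
    hankelT n q a b = 0 := by
  simp only [hankelT]
  have ha := a.is_lt
  rw [hq _ (by have := Fin.lt_def.mp hba; omega), mul_zero]

/-- … with diagonal `(−1)^a · C(n,a) · q_n`. -/
theorem hankelT_OZ_diag (n : ℕ) (q : ℕ → R) (a : Fin (n + 1)) :
    hankelT n q a a = (-1 : R) ^ (a : ℕ) * (n.choose (a : ℕ) : R) * q n := by
  simp only [hankelT]
  have ha := a.is_lt
  rw [show n - (a : ℕ) + (a : ℕ) = n by omega]

/-- O_Z-type shapes: `T_f − μ` is upper triangular, so `det(T_f − μ) = ∏_a ((−1)^a C(n,a) q_n − μ)`. -/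
theorem det_hankelT_OZ_sub (n : ℕ) (q : ℕ → R) (hq : ∀ i < n, q i = 0) (μ : R) :
    (hankelT n q - μ • (1 : Matrix (Fin (n + 1)) (Fin (n + 1)) R)).det =
      ∏ a : Fin (n + 1), ((-1 : R) ^ (a : ℕ) * (n.choose (a : ℕ) : R) * q n - μ) := by
  rw [Matrix.det_of_upperTriangular]
  · refine Finset.prod_congr rfl fun a _ => ?_
    rw [Matrix.sub_apply, hankelT_OZ_diag, Matrix.smul_apply, one_apply_eq, smul_eq_mul, mul_one]
  · intro a b hba
    dsimp only [id] at hba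
    rw [Matrix.sub_apply, hankelT_OZ_lower_eq_zero n q hq hba, Matrix.smul_apply, one_apply_ne (ne_of_gt hba), smul_zero,
      sub_zero]

/-- **(C6), matrix form:** for every O_Z-type shape, `det(M_f − λ) = ∏_a ((−1)ⁿ q_n² C(n,a)² − λ)` — the candidate
middle-degree loci `λ = (−1)ⁿτ` of every O_Z-type shape are the carrier's `τ = q_n²·C(n,a)²`. -/
theorem det_middleM_OZ_sub (n : ℕ) (q : ℕ → R) (hq : ∀ i < n, q i = 0) (lam : R) :
    (middleM n q - lam • (1 : Matrix (Fin (n + 1)) (Fin (n + 1)) R)).det =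
      ∏ a : Fin (n + 1), ((-1 : R) ^ n * q n ^ 2 * (n.choose (a : ℕ) : R) ^ 2 - lam) := by
  rw [middleM_eq_smul_hankelT_sq, Matrix.det_of_upperTriangular]
  · refine Finset.prod_congr rfl fun a _ => ?_
    simp only [Matrix.sub_apply, Matrix.smul_apply, one_apply_eq, smul_eq_mul, mul_one, Matrix.mul_apply]
    rw [Finset.sum_eq_single a, hankelT_OZ_diag]
    · have h : ((-1 : R) ^ (a : ℕ)) * ((-1 : R) ^ (a : ℕ)) = 1 := by
        rw [← pow_add, ← two_mul, pow_mul, neg_one_sq, one_pow]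
      linear_combination ((-1 : R) ^ n * q n ^ 2 * (n.choose (a : ℕ) : R) ^ 2) * h
    · intro b _ hb
      rcases lt_or_gt_of_ne hb with h | h
      · rw [hankelT_OZ_lower_eq_zero n q hq h, zero_mul]
      · rw [hankelT_OZ_lower_eq_zero n q hq h, mul_zero]
    · intro h; exact (h (Finset.mem_univ a)).elim
  · intro a b hba
    dsimp only [id] at hba
    have hz : (hankelT n q * hankelT n q) a b = 0 := by
      rw [Matrix.mul_apply]
      refine Finset.sum_eq_zero fun m _ => ?_
      by_cases h1 : m < a
      · rw [hankelT_OZ_lower_eq_zero n q hq h1, zero_mul]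
      · rw [hankelT_OZ_lower_eq_zero n q hq (lt_of_lt_of_le hba (not_lt.mp h1)), mul_zero]
    rw [Matrix.sub_apply, Matrix.smul_apply, hz, smul_zero, Matrix.smul_apply, one_apply_ne (ne_of_gt hba), smul_zero,
      sub_zero]

end Ring

section Field

variable {K : Type*} [Field K] [DecidableEq K]

omit [Field K] [DecidableEq K] in
/-- `λ·1 = diag(λ, …, λ)`. -/
lemma smul_one_eq_diagonal_const {R : Type*} [CommRing R] {m : Type*} [Fintype m] [DecidableEq m] (lam : R) :
    lam • (1 : Matrix m m R) = diagonal (fun _ => lam) := by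
  ext i j
  rw [Matrix.smul_apply, one_apply, diagonal_apply]
  split_ifs <;> simp

/-- the kernel of a diagonal matrix has dimension the number of zero diagonal entries. -/
theorem finrank_ker_diagonal {m : Type*} [Fintype m] [DecidableEq m] (d : m → K) :
    Module.finrank K (LinearMap.ker (diagonal d).mulVecLin) = (Finset.univ.filter fun a => d a = 0).card := by
  have h := card_eq_rank_add_finrank_ker (diagonal d)
  rw [Matrix.rank_diagonal, Fintype.card_subtype] at h
  have hc := Finset.card_filter_add_card_filter_not (s := (Finset.univ : Finset m)) (fun a => d a ≠ 0)
  rw [Finset.card_univ] at hc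
  have e : (Finset.univ.filter fun a => ¬ d a ≠ 0) = (Finset.univ.filter fun a => d a = 0) :=
    Finset.filter_congr (fun a _ => not_ne_iff)
  rw [e] at hc
  omega

/-- **(C1), kernel form:** for the carrier `q_i = [i = n]·c` and any `λ`, `dim ker(M_f − λ) = #{a ≤ n : (−1)ⁿ c² C(n,a)² = λ}`.
With `λ = (−1)ⁿτ`: the middle degree of THEOREM R_f drops by `#{m : τ = c²·C(n,m)²}` — two on the loci `t = C(n,m)²`,
`m ≠ n/2`, one on `t = C(n,n/2)²` (`n` even), zero elsewhere. -/
theorem finrank_ker_middleM_carrier (n : ℕ) (c lam : K) :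
    Module.finrank K (LinearMap.ker
      (middleM n (fun i => if i = n then c else 0) - lam • (1 : Matrix (Fin (n + 1)) (Fin (n + 1)) K)).mulVecLin) =
      (Finset.univ.filter fun a : Fin (n + 1) => (-1 : K) ^ n * c ^ 2 * (n.choose (a : ℕ) : K) ^ 2 = lam).card := by
  rw [middleM_carrier, smul_one_eq_diagonal_const, diagonal_sub, finrank_ker_diagonal]
  congr 1
  exact Finset.filter_congr (fun a _ => sub_eq_zero)

/-- the carrier at `n = 3` (Weil sixfold; `O_Z` of a threefold carrier): the middle degree drops exactly where
`t = τ/q₃² = C(3,a)²`, i.e. on `t ∈ {1, 9}` — the loci `(w,w)_χ ∈ {2, 18}·D·q₃²` of (C1) — by two each … -/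
example : (Finset.univ.filter fun a : Fin (3 + 1) => (Nat.choose 3 (a : ℕ)) ^ 2 = 9).card = 2 := by decide

/-- … (the other locus) … -/
example : (Finset.univ.filter fun a : Fin (3 + 1) => (Nat.choose 3 (a : ℕ)) ^ 2 = 1).card = 2 := by decide

/-- … and nowhere else (e.g. `t = 4` is not a locus); at `n = 4` the value `t = C(4,2)² = 36` is hit once (drop by one:
`479` in (C1)'s eightfold row). -/
example : (Finset.univ.filter fun a : Fin (3 + 1) => (Nat.choose 3 (a : ℕ)) ^ 2 = 4).card = 0 ∧
    (Finset.univ.filter fun a : Fin (4 + 1) => (Nat.choose 4 (a : ℕ)) ^ 2 = 36).card = 1 := by decide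

end Field

end Summit.Ventures.HSemireg.Mod4Site
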